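import Literature.MathematicalPhysics.QuantumFieldTheory.Balaban1983to89.Node00.WilsonActionSecondVariationNearFlat
import Literature.MathematicalPhysics.QuantumFieldTheory.Balaban1983to89.B15SU2ChartHolomorphic
import Literature.MathematicalPhysics.QuantumFieldTheory.Balaban1983to89.B15Prop1SliceIneq18
import Literature.MathematicalPhysics.QuantumFieldTheory.Balaban1983to89.B15Prop1ChartSU2

/-!
# `Balaban1983to89.B16Ineq19FlatSliceChart` — T. Bałaban, *Large field renormalization. II. Localization, exponentiation, and bounds for the
# 𝐑 operation*, Commun. Math. Phys. **122** (1989) 355–392 [Balaban1989LargeFieldII], Sect. 1 pp. 357–358: «The leading term in the expansion is the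
# quadratic form with the background field identically equal to 1 … The inequalities (1.7), (1.8) imply finally ⟨H_{1,k}B′, Δ₁(ζ₀)H_{1,k}B′⟩ ≧
# γ₀∕(2d(100M)⁵)‖B′‖², (1.9)» — THE (1.8)-JUNCTION AT THE FLAT BACKGROUND: n12-c's LEFT chart `expMul su2Chart` at `U = 1` IS n07-e∕n12-w2's RIGHT chart
# `Node00.expChart 1` through the `ℝ³ ≅ 𝔰𝔲(2)` coordinate; the flat second variation of the Wilson action along the SLICE chart is the `ℝ³` curl energy
# `Σ_p ‖(∂B′)(p)‖²`; hence by the PROVED (1.8) (`B15Prop1SliceIneq18.sliceNormSq_le`) it is COERCIVE on the axial-gauge slice — (1.9) at `U₀ = 1` for the bare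
# action, `γ₀ = 1`, no error term.  PROVED.

Honest framing: statement-level skeleton of published theorems with citation tags; proofs where landed; nothing here is a claim about the
Yang–Mills mass gap.

Cell `pub-ymgap` (HUMAN RULINGS D-0062 ∕ D-0149), WIDTH SEAT `pub-ymgap-dag-n12-w3` g0 (node N12 = [B15]; key K1⁷ `stmt-QuantumFields-20542`, `--kind proof
--supports …`; count-neutral); lane word of the N12∕s1 seat dag-n12-c g16 «w3 take (1.8)-junction» (INBOX 2026-08-28 00:08Z) with its pointers (1)–(4).
PDF held: `paper:balaban1989-cmp122-large-field-ii` pp. 357–359 (= PDF 3–5; re-read first-hand).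

WHY.  After `B11Eq177CriticalFamilyDerivative` (this seat) the only analytic letter of the U2b theorems at the flat background is NONDEGENERACY of the flat
second variation on the GAUGE-FIXED kernel (my LOCATED-1: it fails on block averages alone — `D²(A∘expChart 1)(0)` kills every exact field `dλ`), and the N12
chain's (L2) letter `hlead` ∕ its one-sided feeder `h17` (`B15Prop1SliceIneq18.ineq19_slice_of_17`) are written on n12-c's SLICE `GaugeSlice S T ℝ³` through the
LEFT chart `expMul su2Chart (ιA X) ·` ([IV] (1.74): `exp(iB′)·V`), while the second variation of the Wilson action is typed (n12-w2, `Node00.WilsonActionSecondVariation*`)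
on n07-e's RIGHT chart `Node00.expChart U X = U·exp X`, `X : bonds → 𝔰𝔲(N)`.  Pointer (3) of the lane word: «the (1.8)-junction at the flat background therefore needs only
the `E3 ↔ lieSU` identification of `expPoint` with `expSU` and of my `curl(ιA X)²` energy with w2's plaquette-square form».  This module types exactly that.

WHAT THIS FILE PROVES (theorems only; no `def`, no `instance`, no `sorry`; axioms standard).
§1 THE `ℝ³ ≅ 𝔰𝔲(2)` COORDINATE (quantified, never defined: «any ℝ-linear `φ : ℝ³ → lieSU (Fin 2)` with `↑(φ v) = quatMatrix (ι v)`»): `quatMatrix_imQuat_mem_lieSU`,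
   ★ `exists_lieSU2Coord` (such a `φ` exists — `LinearMap.codRestrict` of `v ↦ quatMatrix (ι v) = Σ_a v_a E_a`, n12-w1's `B15SU2ChartHolomorphic.quatMatrix_imQuat`),
   `expPoint_eq_expSU` (`su2Chart.iexp v = expSU (φ v)` — `T4QuatExpLog.quatMatrix_exp`), ★ `norm_sq_lieSU2Coord` (`‖φ v‖² = 2‖v‖²` in the pinned Hilbert–Schmidt
   norm (17): `Re Tr(E_a⋆E_b) = 2δ_{ab}`, `trace_genE_mul_genE`), `expMul_su2Chart_one_eq_expChart` ∕ `expMul_su2Chart_smul_one_eq_expChart` (the LEFT chart of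
   [IV] (1.74) at `U = 1` IS the RIGHT chart of NODE 00: `expMul su2Chart A 1 = Node00.expChart 1 (φ ∘ A)`).
§2 ★★ `deriv_deriv_wilsonAction4_expMul_su2Chart_one` — THE FLAT SECOND VARIATION ALONG THE SLICE CHART IS THE `ℝ³` CURL ENERGY:
   `deriv (deriv (s ↦ A(expMul su2Chart (s•A) 1))) 0 = Σ_p ‖A⟨x,μ⟩ + A⟨x+e_μ,ν⟩ − A⟨x+e_ν,μ⟩ − A⟨x,ν⟩‖²_{ℝ³}` for EVERY `A : VecField P k ℝ³` (n12-w2's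
   `deriv_deriv_wilsonAction4_expChart_one_eq_norm_sq` with `N = 2` read through §1; the statement does not mention `φ`) — n12-w4's `hflat` shape at `ζ ≡ 1`;
   `deriv_deriv_wilsonAction4_expMul_su2Chart_one_eq_expChart` (the same number is NODE 00's ray second variation `deriv (deriv (s ↦ A(1·exp(s φA)))) 0`, hence the
   `a₂`-diagonal `D²(A∘expChart 1)(0)(φ∘A, φ∘A)` of `B11Eq177CriticalFamilyDerivative` by that file's `deriv_deriv_wilsonAction4_expChart_smul_eq` — not imported here),
   `deriv_deriv_wilsonAction4_expMul_su2Chart_one_nonneg`.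
§3 THE (1.8) JUNCTION: `curl_pull_component` (n12-c's `B6TreeGaugePoincare.curl` of the `ℤᵈ`-pullback of the `a`-component of a torus field IS the `a`-component of that
   plaquette combination at `⟨castSite z, j, μ⟩`), `curl_pull_component_self` (`= 0` at `μ = j`), ★ `sum_box_curl_sq_le_sum_plaq` (the `h17` left-side sum
   `Σ_{z ∈ box m lo} Σ_μ Σ_a curl(…)(z)(e₀, μ)²` is `≤ Σ_{p : Plaq} ‖combination(p)‖²` for ANY field, once the box does not wrap: `castSite_injOn_box` + dropping
   nonnegative plaquette terms), ★★★ `sliceNormSq_le_secondVariation_flat` — [LF-II] (1.9) AT THE FLAT BACKGROUND FOR THE BARE ACTION: under n12-c's box ∕ axial-tree ∕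
   margin hypotheses (`sliceNormSq_le`'s, verbatim), `‖X‖² ≤ (3K² + 2K⁴) · deriv (deriv (s ↦ A(expMul su2Chart (s • ιA X) 1))) 0` for every `X : GaugeSlice S T ℝ³` —
   the flat second variation is COERCIVE on the axial-gauge slice, hence NONDEGENERATE there (`secondVariation_flat_slice_pos`: `> 0` for `X ≠ 0`);
   `h17_flat` (the exact `h17` binder of `ineq19_slice_of_17` with `γ₀ = 1`, `Cerr = 0`, for ANY pairing `(H, Δ₁)` realising the flat second variation).

HONEST SCOPE — what is NOT claimed.  (i) This is the k = 0 ∕ UN-AVERAGED currency: the Wilson action and the slice live on the SAME lattice `T^{(k)}`.  For the N12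
endpoint at `k ≥ 1` the letter `hlead` concerns the VALUE function `B′ ↦ A(U_{k,Z}(exp(iB′)V_k))`, whose flat slice Hessian is the MINIMUM of the FINE flat second
variation over the linearised fibre (`B11Eq177CriticalFamilyDerivative.hessian_wilsonAction4_flat_expChartFamily`, [10] (1.64)–(1.66)); comparing that minimum
with the COARSE curl energy of this file is [10] (1.67) ∕ [LF-II] (1.7) = U2c (n12-w4's lane), NOT here.  (ii) The two replacement steps of p. 357 (letter (c):
decay of the `Z`-minimiser) are not here.  (iii) `SU(2)` only (the chart `su2Chart` of the N12 chain).  Count-neutral; N12 NOT discharged; the YM mass gap (Clay) is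
NOT proved by any of this — R4 closes only the conditional finite-𝕋⁴ rung `BalabanLadder.UV`; nothing continuum ∕ OS.  CONSUMED BY NAME, nothing modified:
n12-w2 `Node00.deriv_deriv_wilsonAction4_expChart_one_eq_norm_sq` (p587195), n12-w1 `B15SU2ChartHolomorphic.{genE, quatMatrix_imQuat, star_genE, genE_trace,
trace_genE_mul_genE}` (p588458), n12-c `B15Prop1SliceIneq18.sliceNormSq_le` ∕ `B15Prop1SliceCoordinates.{GaugeSlice, ιA}` ∕ `B15Prop1ChartSU2.su2Chart`, n07-e
`Node00.expChart`, pv26 `T4HaarSU2ExpChart.expPoint`, `T4QuatExpLog.quatMatrix_exp`, `T4AxialGaugeSmallField.castSite{_add_e,_injOn_box}`, `B6TreeGaugePoincare.curl`,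
`B16Eq18Proof.box`.  0 kit, 0 lit wants.

## References
* [Balaban1989LargeFieldII] T. Bałaban, Commun. Math. Phys. 122 (1989) 355–392: p. 357 («the quadratic form with the background field identically equal to 1»),
  (1.7)–(1.9) p. 358, (1.12) p. 359, (1.19) p. 360 (`V′ = exp ig_kB`).
* [Balaban1989LargeFieldI] T. Bałaban, Commun. Math. Phys. 122 (1989) 175–202: (1.74) p. 192, Prop. 1 p. 194.
* [Balaban1985BackgroundPropagators] T. Bałaban, Commun. Math. Phys. 99 (1985) 389–434: (3.6)–(3.7) p. 391, (3.10) p. 392 (the second variation `⟨X, Δ(U)X⟩`).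
* [Balaban1984PropagatorsI] T. Bałaban, Commun. Math. Phys. 95 (1984) 17–40: (1.4) p. 18 (the lattice curl), (1.64)–(1.67) p. 29.
-/

noncomputable section

open Set Finset Filter Topology

namespace Literature.MathematicalPhysics.QuantumFieldTheory.Balaban1983to89.B16Ineq19FlatSliceChart

open T4Continuum B16Sect1Backgrounds B15DeterminingSets GaugeField
open Literature.MathematicalPhysics.QuantumLattice (quatMatrix coe_quatToSU2_of_norm_eq_one)
open T4QuatExpLog (quatMatrix_exp)
open T4HaarSU2ExpChart (imQuat imQuat_apply expPoint norm_exp_imQuat)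
open T4AdjointCovarianceUnitary (lieSU expSU coe_expSU mem_lieSU_iff)
open T4CubeChartGnomonic (SU2)
open B15Prop1ChartSU2 (su2Chart su2Chart_iexp)
open B15SU2ChartHolomorphic (genE quatMatrix_imQuat star_genE genE_trace trace_genE_mul_genE)
open B15Prop1SliceCoordinates (GaugeSlice ιA freeBonds)
open B15Prop1SliceIneq18 (sliceNormSq_le)
open T4AxialGaugeSmallField (castSite castSite_add_e castSite_injOn_box)
open B7Prop1Explicit (e e_apply)
open B6BondElimination (unitVec unitVec_apply)
open B6TreeGaugePoincare (curl)
open B16Eq18Proof (box mem_box)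
open Node00 (SU expChart deriv_deriv_wilsonAction4_expChart_one_eq_norm_sq)
open scoped Matrix.Norms.L2Operator Quaternion

/-! ## §1  The `ℝ³ ≅ 𝔰𝔲(2)` coordinate: `v ↦ quatMatrix (ι v) = Σ_a v_a E_a`, and the two exponential charts at `U = 1` -/

section Coordinate

/-- `quatMatrix (ι v) = Σ_a v_a E_a` is trace-free skew-Hermitian: an element of `𝔰𝔲(2)` (`lieSU (Fin 2)` of `T4AdjointCovarianceUnitary`).
[cite: Balaban1989LargeFieldII, (1.19) p.360 (bookkeeping)] -/
theorem quatMatrix_imQuat_mem_lieSU (v : EuclideanSpace ℝ (Fin 3)) : quatMatrix (imQuat v) ∈ lieSU (Fin 2) := by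
  rw [mem_lieSU_iff, quatMatrix_imQuat]
  constructor
  · rw [star_sum, ← Finset.sum_neg_distrib]
    refine Finset.sum_congr rfl fun a _ => ?_
    rw [star_smul, star_genE, smul_neg, Complex.star_def, Complex.conj_ofReal]
  · rw [Matrix.trace_sum]
    refine Finset.sum_eq_zero fun a _ => ?_
    rw [Matrix.trace_smul, genE_trace, smul_zero]

/-- ★ **THE COORDINATE EXISTS**: an ℝ-linear `φ : ℝ³ → 𝔰𝔲(2)` with `↑(φ v) = quatMatrix (ι v)` (the map print writes `B ↦ iΣ_a B^aσ_a`; every theorem below takes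
ANY such `φ`, so no definition is introduced). [cite: Balaban1989LargeFieldII, (1.19) p.360] -/
theorem exists_lieSU2Coord :
    ∃ φ : EuclideanSpace ℝ (Fin 3) →ₗ[ℝ] lieSU (Fin 2), ∀ v, ((φ v : lieSU (Fin 2)) : Matrix (Fin 2) (Fin 2) ℂ) = quatMatrix (imQuat v) := by
  let L : EuclideanSpace ℝ (Fin 3) →ₗ[ℝ] Matrix (Fin 2) (Fin 2) ℂ :=
    { toFun := fun v => quatMatrix (imQuat v)
      map_add' := fun v w => by
        simp only [quatMatrix_imQuat, PiLp.add_apply, Complex.ofReal_add, add_smul, Finset.sum_add_distrib]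
      map_smul' := fun c v => by
        simp only [quatMatrix_imQuat, PiLp.smul_apply, smul_eq_mul, Complex.ofReal_mul, RingHom.id_apply, Finset.smul_sum]
        refine Finset.sum_congr rfl fun a _ => ?_
        rw [← smul_smul, Complex.coe_smul] }
  exact ⟨L.codRestrict (lieSU (Fin 2)) fun v => quatMatrix_imQuat_mem_lieSU v, fun v => rfl⟩

variable {φ : EuclideanSpace ℝ (Fin 3) →ₗ[ℝ] lieSU (Fin 2)}

/-- **THE TWO EXPONENTIALS AGREE**: `su2Chart.iexp v = expPoint v = quatToSU2 (exp (ι v))` IS `expSU (φ v) = exp (quatMatrix (ι v))` (`quatMatrix` commutes with `exp`).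
[cite: Balaban1989LargeFieldII, (1.19) p.360; Balaban1988Convergent, (1.19) p.250] -/
theorem expPoint_eq_expSU (hφ : ∀ v, ((φ v : lieSU (Fin 2)) : Matrix (Fin 2) (Fin 2) ℂ) = quatMatrix (imQuat v))
    (v : EuclideanSpace ℝ (Fin 3)) : expPoint v = expSU (φ v) := by
  apply Subtype.ext
  rw [coe_expSU, hφ, expPoint, coe_quatToSU2_of_norm_eq_one (norm_exp_imQuat v), quatMatrix_exp]

/-- ★ **THE COORDINATE SCALES THE NORM BY `√2`**: `‖φ v‖² = 2‖v‖²` for the pinned Hilbert–Schmidt norm (17) of `𝔰𝔲(2)` (`‖X‖² = Re Tr(X⋆X)`,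
`Tr(E_aE_b) = −2δ_{ab}`). [cite: Balaban1985Averaging, (17) p.21; Balaban1989LargeFieldII, (1.19) p.360] -/
theorem norm_sq_lieSU2Coord (hφ : ∀ v, ((φ v : lieSU (Fin 2)) : Matrix (Fin 2) (Fin 2) ℂ) = quatMatrix (imQuat v))
    (v : EuclideanSpace ℝ (Fin 3)) : ‖φ v‖ ^ 2 = 2 * ‖v‖ ^ 2 := by
  rw [Node00.norm_sq_lieSU_eq_re_trace, hφ, quatMatrix_imQuat, star_sum]
  have hstar : ∀ a : Fin 3, star ((((v a : ℝ) : ℂ)) • genE a) = -((((v a : ℝ) : ℂ)) • genE a) := fun a => by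
    rw [star_smul, star_genE, smul_neg, Complex.star_def, Complex.conj_ofReal]
  simp only [hstar, Finset.sum_neg_distrib, neg_mul, Matrix.trace_neg, Finset.sum_mul, Finset.mul_sum,
    Matrix.trace_sum, smul_mul_assoc, mul_smul_comm, Matrix.trace_smul, smul_eq_mul, trace_genE_mul_genE]
  simp only [mul_ite, mul_neg, mul_zero, Finset.sum_ite_eq', Finset.mem_univ, if_true, Complex.re_sum, neg_neg]
  rw [EuclideanSpace.norm_sq_eq]
  rw [Finset.mul_sum]
  refine Finset.sum_congr rfl fun a _ => ?_
  simp only [Complex.mul_re, Complex.ofReal_re, Complex.ofReal_im, mul_zero, sub_zero, Complex.re_ofNat, Complex.im_ofNat,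
    Real.norm_eq_abs, sq_abs]
  ring

variable {P : Params} {k : ℕ}

/-- **n12-c's LEFT CHART AT `U = 1` IS NODE 00's RIGHT CHART**: `expMul su2Chart A 1 = Node00.expChart 1 (φ ∘ A)` (`exp(iA)·1 = 1·exp(φA)`).
[cite: Balaban1989LargeFieldI, (1.74) p.192; Balaban1989LargeFieldII, (1.19) p.360] -/
theorem expMul_su2Chart_one_eq_expChart (hφ : ∀ v, ((φ v : lieSU (Fin 2)) : Matrix (Fin 2) (Fin 2) ℂ) = quatMatrix (imQuat v))
    (A : VecField P k (EuclideanSpace ℝ (Fin 3))) :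
    expMul su2Chart A (1 : GaugeField P k SU2) = expChart (1 : GaugeField P k (SU 2)) (fun b => φ (A b)) := by
  funext b
  show su2Chart.iexp (A b) * (1 : SU2) = (1 : SU2) * expSU (φ (A b))
  rw [mul_one, one_mul, su2Chart_iexp, expPoint_eq_expSU hφ]

/-- The same along the ray: `expMul su2Chart (s•A) 1 = Node00.expChart 1 (s • (φ ∘ A))`. [cite: Balaban1989LargeFieldII, (1.19) p.360 (bookkeeping)] -/
theorem expMul_su2Chart_smul_one_eq_expChart (hφ : ∀ v, ((φ v : lieSU (Fin 2)) : Matrix (Fin 2) (Fin 2) ℂ) = quatMatrix (imQuat v))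
    (A : VecField P k (EuclideanSpace ℝ (Fin 3))) (s : ℝ) :
    expMul su2Chart (s • A) (1 : GaugeField P k SU2) = expChart (1 : GaugeField P k (SU 2)) (s • fun b => φ (A b)) := by
  rw [expMul_su2Chart_one_eq_expChart hφ]
  congr 1
  funext b
  simp only [Pi.smul_apply, map_smul]

end Coordinate

/-! ## §2  The flat second variation along the slice chart is the `ℝ³` curl energy -/

section SecondVariation

variable {P : Params} {k : ℕ}

/-- ★★ **THE FLAT SECOND VARIATION OF THE WILSON ACTION ALONG n12-c's CHART IS THE `ℝ³` CURL ENERGY**: for every `ℝ³`-valued bond field `A` on `T^{(k)}`,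
`d²∕ds² A(exp(isA)·1)∣₀ = Σ_p ‖A⟨x,μ⟩ + A⟨x+e_μ,ν⟩ − A⟨x+e_ν,μ⟩ − A⟨x,ν⟩‖²` (plaquettes `p = ⟨x, μ < ν⟩`; the Euclidean norm of `ℝ³`) — print's «the quadratic form
with the background field identically equal to 1» ([LF-II] p. 357), n12-w2's `(1∕N)·Σ_p ‖·‖²_{HS}` at `N = 2` divided through by `‖φ v‖² = 2‖v‖²`.  The statement
does not mention the coordinate `φ`. [cite: Balaban1989LargeFieldII, p.357, (1.7) p.358; Balaban1985BackgroundPropagators, (3.6)–(3.7) p.391, (3.10) p.392] -/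
theorem deriv_deriv_wilsonAction4_expMul_su2Chart_one (A : VecField P k (EuclideanSpace ℝ (Fin 3))) :
    deriv (deriv fun s : ℝ => wilsonAction4 (expMul su2Chart (s • A) (1 : GaugeField P k SU2))) 0
      = ∑ p : Plaq P k, ‖A ⟨p.src, p.μ⟩ + A ⟨p.src.shift p.μ, p.ν⟩ - A ⟨p.src.shift p.ν, p.μ⟩ - A ⟨p.src, p.ν⟩‖ ^ 2 := by
  obtain ⟨φ, hφ⟩ := exists_lieSU2Coord
  have hfun : (fun s : ℝ => wilsonAction4 (expMul su2Chart (s • A) (1 : GaugeField P k SU2)))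
      = fun s : ℝ => wilsonAction4 (expChart (1 : GaugeField P k (SU 2)) (s • fun b => φ (A b))) := by
    funext s
    rw [expMul_su2Chart_smul_one_eq_expChart hφ]
  rw [hfun, deriv_deriv_wilsonAction4_expChart_one_eq_norm_sq]
  have hcomb : ∀ p : Plaq P k,
      ‖φ (A ⟨p.src, p.μ⟩) + φ (A ⟨p.src.shift p.μ, p.ν⟩) - φ (A ⟨p.src.shift p.ν, p.μ⟩) - φ (A ⟨p.src, p.ν⟩)‖ ^ 2
        = 2 * ‖A ⟨p.src, p.μ⟩ + A ⟨p.src.shift p.μ, p.ν⟩ - A ⟨p.src.shift p.ν, p.μ⟩ - A ⟨p.src, p.ν⟩‖ ^ 2 := fun p => by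
    rw [← map_add, ← map_sub, ← map_sub, norm_sq_lieSU2Coord hφ]
  simp only [hcomb, ← Finset.mul_sum, Fintype.card_fin, Nat.cast_ofNat]
  ring

/-- The same number in NODE 00's chart currency: `d²∕ds² A(exp(isA)·1)∣₀ = d²∕ds² A(1·exp(s φA))∣₀` — so it is the diagonal value `D²(A∘expChart 1)(0)(φA, φA)` of the
Fréchet Hessian (`B11Eq177CriticalFamilyDerivative.deriv_deriv_wilsonAction4_expChart_smul_eq`), the `a₂` of the U2b theorems, for any coordinate `φ`.
[cite: Balaban1989LargeFieldII, (1.12) p.359; Balaban1985BackgroundPropagators, (3.6)–(3.7) p.391 (bookkeeping)] -/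
theorem deriv_deriv_wilsonAction4_expMul_su2Chart_one_eq_expChart {φ : EuclideanSpace ℝ (Fin 3) →ₗ[ℝ] lieSU (Fin 2)}
    (hφ : ∀ v, ((φ v : lieSU (Fin 2)) : Matrix (Fin 2) (Fin 2) ℂ) = quatMatrix (imQuat v)) (A : VecField P k (EuclideanSpace ℝ (Fin 3))) :
    deriv (deriv fun s : ℝ => wilsonAction4 (expMul su2Chart (s • A) (1 : GaugeField P k SU2))) 0
      = deriv (deriv fun s : ℝ => wilsonAction4 (expChart (1 : GaugeField P k (SU 2)) (s • fun b => φ (A b)))) 0 := by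
  have hfun : (fun s : ℝ => wilsonAction4 (expMul su2Chart (s • A) (1 : GaugeField P k SU2)))
      = fun s : ℝ => wilsonAction4 (expChart (1 : GaugeField P k (SU 2)) (s • fun b => φ (A b))) := by
    funext s
    rw [expMul_su2Chart_smul_one_eq_expChart hφ]
  rw [hfun]

/-- The flat second variation along the slice chart is nonnegative. [cite: Balaban1989LargeFieldII, p.357 («This quadratic form is positive definite»)] -/
theorem deriv_deriv_wilsonAction4_expMul_su2Chart_one_nonneg (A : VecField P k (EuclideanSpace ℝ (Fin 3))) :
    0 ≤ deriv (deriv fun s : ℝ => wilsonAction4 (expMul su2Chart (s • A) (1 : GaugeField P k SU2))) 0 := by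
  rw [deriv_deriv_wilsonAction4_expMul_su2Chart_one]
  exact Finset.sum_nonneg fun p _ => by positivity

end SecondVariation

/-! ## §3  The (1.8) junction: n12-c's box-curl sum is dominated by the flat second variation; coercivity on the axial-gauge slice -/

section Junction

variable {P : Params} {k : ℕ}

/-- The two unit-vector notations of the cell agree. [folklore] -/
private theorem unitVec_eq_e' (μ : Fin P.d) : (unitVec μ : Fin P.d → ℤ) = e μ := by
  funext i; simp [unitVec_apply, e_apply]

/-- `castSite (z + unitVec μ) = (castSite z).shift μ`. [folklore] -/
private theorem castSite_add_unitVec' (z : Fin P.d → ℤ) (μ : Fin P.d) :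
    (castSite (z + unitVec μ) : Site P k) = (castSite z).shift μ := by
  rw [unitVec_eq_e', castSite_add_e]

/-- **n12-c's `ℤᵈ`-CURL OF THE PULLED-BACK COMPONENT IS THE TORUS PLAQUETTE COMBINATION**: for any `ℝ³`-valued torus field `A`, colour `a`, base `z` and directions
`j, μ`: `curl (b ↦ A⟨castSite b.1, b.2⟩_a) z j μ = (A⟨x,j⟩ + A⟨x+e_j,μ⟩ − A⟨x+e_μ,j⟩ − A⟨x,μ⟩)_a`, `x = castSite z`.
[cite: Balaban1984PropagatorsI, (1.4) p.18; Balaban1989LargeFieldII, (1.8) p.358 (bookkeeping)] -/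
theorem curl_pull_component (A : VecField P k (EuclideanSpace ℝ (Fin 3))) (z : Fin P.d → ℤ) (j μ : Fin P.d) (a : Fin 3) :
    curl (fun b : (Fin P.d → ℤ) × Fin P.d => A (⟨castSite b.1, b.2⟩ : PBond P k) a) z j μ
      = (A ⟨castSite z, j⟩ + A ⟨(castSite z : Site P k).shift j, μ⟩ - A ⟨(castSite z : Site P k).shift μ, j⟩ - A ⟨castSite z, μ⟩) a := by
  simp only [curl, castSite_add_unitVec', PiLp.add_apply, PiLp.sub_apply]

/-- The diagonal entries vanish: `curl … z j j = 0`. [cite: Balaban1984PropagatorsI, (1.4) p.18 (bookkeeping)] -/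
theorem curl_pull_component_self (A : VecField P k (EuclideanSpace ℝ (Fin 3))) (z : Fin P.d → ℤ) (j : Fin P.d) (a : Fin 3) :
    curl (fun b : (Fin P.d → ℤ) × Fin P.d => A (⟨castSite b.1, b.2⟩ : PBond P k) a) z j j = 0 := by
  rw [curl_pull_component]
  simp

/-- `Σ_a w_a² = ‖w‖²` on `ℝ³`. [folklore] -/
private theorem sum_sq_eq_norm_sq (w : EuclideanSpace ℝ (Fin 3)) : ∑ a, w a ^ 2 = ‖w‖ ^ 2 := by
  rw [EuclideanSpace.norm_sq_eq]
  refine Finset.sum_congr rfl fun a _ => ?_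
  rw [Real.norm_eq_abs, sq_abs]

/-- ★ **THE `h17` LEFT-SIDE SUM IS DOMINATED BY THE FULL PLAQUETTE SUM**: for ANY `ℝ³`-valued torus field `A` and any box `box m lo` that does not wrap
(`m κ ≤ sitesPerDir k`), `Σ_{z ∈ box m lo} Σ_μ Σ_a curl(…)(z)(e₀, μ)² ≤ Σ_{p : Plaq} ‖A⟨x,μ⟩ + A⟨x+e_μ,ν⟩ − A⟨x+e_ν,μ⟩ − A⟨x,ν⟩‖²` — the `(e₀, μ)`-terms, `μ > 0`,
are the plaquettes `⟨castSite z, e₀, μ⟩` counted once each (`castSite_injOn_box`), the `μ = 0` terms vanish, every other plaquette contributes `≥ 0`.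
[cite: Balaban1989LargeFieldII, (1.7)–(1.8) p.358] -/
theorem sum_box_curl_sq_le_sum_plaq (h0 : 0 < P.d) (h1 : 1 < P.d) {m : Fin P.d → ℕ} {lo : Fin P.d → ℤ}
    (hm : ∀ κ, (m κ : ℤ) ≤ P.sitesPerDir k) (A : VecField P k (EuclideanSpace ℝ (Fin 3))) :
    ∑ z ∈ box m lo, ∑ μ : Fin P.d, ∑ a : Fin 3, curl (fun b : (Fin P.d → ℤ) × Fin P.d => A (⟨castSite b.1, b.2⟩ : PBond P k) a) z ⟨0, h0⟩ μ ^ 2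
      ≤ ∑ p : Plaq P k, ‖A ⟨p.src, p.μ⟩ + A ⟨p.src.shift p.μ, p.ν⟩ - A ⟨p.src.shift p.ν, p.μ⟩ - A ⟨p.src, p.ν⟩‖ ^ 2 := by
  classical
  -- the plaquette combination as a function of the plaquette
  set F : Plaq P k → ℝ := fun p =>
    ‖A ⟨p.src, p.μ⟩ + A ⟨p.src.shift p.μ, p.ν⟩ - A ⟨p.src.shift p.ν, p.μ⟩ - A ⟨p.src, p.ν⟩‖ ^ 2 with hF
  have hF0 : ∀ p, 0 ≤ F p := fun p => by positivity
  have h01 : (⟨0, h0⟩ : Fin P.d) < ⟨1, h1⟩ := Fin.mk_lt_mk.2 zero_lt_one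
  -- the index map `(z, μ) ↦ ⟨castSite z, e₀, μ⟩` (junk value `⟨castSite z, e₀, e₁⟩` off `e₀ < μ`)
  let g : (Fin P.d → ℤ) × Fin P.d → Plaq P k := fun zμ =>
    if h : (⟨0, h0⟩ : Fin P.d) < zμ.2 then ⟨castSite zμ.1, ⟨0, h0⟩, zμ.2, h⟩ else ⟨castSite zμ.1, ⟨0, h0⟩, ⟨1, h1⟩, h01⟩
  let s : Finset ((Fin P.d → ℤ) × Fin P.d) := box m lo ×ˢ (Finset.univ.filter fun μ => (⟨0, h0⟩ : Fin P.d) < μ)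
  -- Step 1: each `(z, μ)` term is `F (g (z, μ))` for `e₀ < μ` and `0` for `μ = e₀`
  have hterm : ∀ z μ, ∑ a : Fin 3, curl (fun b : (Fin P.d → ℤ) × Fin P.d => A (⟨castSite b.1, b.2⟩ : PBond P k) a) z ⟨0, h0⟩ μ ^ 2
      = if (⟨0, h0⟩ : Fin P.d) < μ then F (g (z, μ)) else 0 := by
    intro z μ
    by_cases hμ : (⟨0, h0⟩ : Fin P.d) < μ
    · rw [if_pos hμ]
      simp only [curl_pull_component, sum_sq_eq_norm_sq, hF, g, dif_pos hμ]
    · rw [if_neg hμ]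
      have hμ0 : μ = ⟨0, h0⟩ := by
        have hv : μ.val ≤ 0 := Fin.le_iff_val_le_val.1 (not_lt.1 hμ)
        exact Fin.ext (by simpa using hv)
      subst hμ0
      simp only [curl_pull_component_self]
      simp
  -- Step 2: the left side is the sum of `F ∘ g` over the index set `s`
  have hL : ∑ z ∈ box m lo, ∑ μ : Fin P.d, ∑ a : Fin 3,
        curl (fun b : (Fin P.d → ℤ) × Fin P.d => A (⟨castSite b.1, b.2⟩ : PBond P k) a) z ⟨0, h0⟩ μ ^ 2
      = ∑ zμ ∈ s, F (g zμ) := by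
    rw [Finset.sum_product]
    refine Finset.sum_congr rfl fun z _ => ?_
    rw [Finset.sum_filter]
    exact Finset.sum_congr rfl fun μ _ => hterm z μ
  -- Step 3: `g` is injective on `s` (the box does not wrap)
  have hinj : ∀ x ∈ s, ∀ y ∈ s, g x = g y → x = y := by
    rintro ⟨z, μ⟩ hz ⟨z', μ'⟩ hz' heq
    simp only [s, Finset.mem_product, Finset.mem_filter, Finset.mem_univ, true_and, mem_box] at hz hz'
    have hgz : g (z, μ) = ⟨castSite z, ⟨0, h0⟩, μ, hz.2⟩ := dif_pos hz.2
    have hgz' : g (z', μ') = ⟨castSite z', ⟨0, h0⟩, μ', hz'.2⟩ := dif_pos hz'.2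
    rw [hgz, hgz'] at heq
    have hsrc : (castSite z : Site P k) = castSite z' := congrArg Plaq.src heq
    have hνν : μ = μ' := congrArg Plaq.ν heq
    have hzz : z = z' :=
      castSite_injOn_box (j := k) (lo := lo) (hi := fun κ => lo κ + m κ - 1)
        (fun κ => by have := hm κ; show lo κ + (m κ : ℤ) - 1 - lo κ < P.sitesPerDir k; omega)
        (fun κ => (hz.1 κ).1) (fun κ => by have := (hz.1 κ).2; show z κ ≤ lo κ + (m κ : ℤ) - 1; omega)
        (fun κ => (hz'.1 κ).1) (fun κ => by have := (hz'.1 κ).2; show z' κ ≤ lo κ + (m κ : ℤ) - 1; omega) hsrc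
    rw [hzz, hνν]
  -- Step 4: reindex and drop the remaining (nonnegative) plaquette terms
  rw [hL, ← Finset.sum_image hinj]
  exact Finset.sum_le_sum_of_subset_of_nonneg (Finset.subset_univ _) fun p _ _ => hF0 p

variable [DecidableEq (PBond P k)]

/-- ★★★ **[LF-II] (1.9) AT THE FLAT BACKGROUND FOR THE BARE ACTION — THE FLAT SECOND VARIATION IS COERCIVE ON THE AXIAL-GAUGE SLICE**: under the hypotheses
of n12-c's PROVED (1.8) `B15Prop1SliceIneq18.sliceNormSq_le` (the box `Λ^{(k)} = castSite″(box n lo)` with margins `n_κ + 5 < sitesPerDir k`, sides `n₀, n₁ ≤ K`, the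
`x₁`-axial tree `G₀`), every coordinate vector `X : GaugeSlice S T ℝ³` satisfies
`‖X‖² ≤ (3K² + 2K⁴) · d²∕ds² A(exp(is·ιA X)·1)∣₀` — «(1.7), (1.8) imply finally ⟨…⟩ ≥ γ₀∕(2d(100M)⁵)‖B′‖²» at `U₀ = 1`, `γ₀ = 1`, no error term, in the
cell's constant `3K² + 2K⁴` (the one `hsm`∕`hγle` of the N12 endpoint carry). [cite: Balaban1989LargeFieldII, (1.7)–(1.9) p.358, p.357] -/
theorem sliceNormSq_le_secondVariation_flat (h0 : 0 < P.d) (h1 : 1 < P.d) {lo : Fin P.d → ℤ} {n : Fin P.d → ℕ}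
    (hN : ∀ κ, (n κ : ℤ) + 5 < P.sitesPerDir k) {K : ℕ} (hK0 : n ⟨0, h0⟩ ≤ K) (hK1 : n ⟨1, h1⟩ ≤ K)
    {S : Set (Site P k)} {T : Finset (PBond P k)}
    (hS : S = castSite '' (↑(box n lo) : Set (Fin P.d → ℤ)))
    (hT : T = (box n lo).image fun x => (⟨castSite (x - unitVec ⟨0, h0⟩), ⟨0, h0⟩⟩ : PBond P k))
    (X : GaugeSlice S T (EuclideanSpace ℝ (Fin 3))) :
    ‖X‖ ^ 2 ≤ (3 * (K : ℝ) ^ 2 + 2 * (K : ℝ) ^ 4) *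
      deriv (deriv fun s : ℝ => wilsonAction4 (expMul su2Chart (s • ιA S T X) (1 : GaugeField P k SU2))) 0 := by
  have h18 := sliceNormSq_le h0 h1 hN hK0 hK1 hS hT X
  rw [deriv_deriv_wilsonAction4_expMul_su2Chart_one]
  refine h18.trans (mul_le_mul_of_nonneg_left ?_ (by positivity))
  exact sum_box_curl_sq_le_sum_plaq h0 h1 (fun κ => by have := hN κ; push_cast; omega) (ιA S T X)

/-- **NONDEGENERACY ON THE SLICE**: the flat second variation along the slice chart is STRICTLY positive at every `X ≠ 0` — the `hnd` letter of
`B11Eq177CriticalFamilyDerivative` §2∕§4 for constraint charts whose kernel lies in the axial-gauge slice, in the bare-action currency.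
[cite: Balaban1989LargeFieldII, (1.9) p.358, p.359 («the operator P₀H*Δ₁HP₀ is positive, hence invertible on this subspace»)] -/
theorem secondVariation_flat_slice_pos (h0 : 0 < P.d) (h1 : 1 < P.d) {lo : Fin P.d → ℤ} {n : Fin P.d → ℕ}
    (hN : ∀ κ, (n κ : ℤ) + 5 < P.sitesPerDir k) {K : ℕ} (hK0 : n ⟨0, h0⟩ ≤ K) (hK1 : n ⟨1, h1⟩ ≤ K)
    {S : Set (Site P k)} {T : Finset (PBond P k)}
    (hS : S = castSite '' (↑(box n lo) : Set (Fin P.d → ℤ)))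
    (hT : T = (box n lo).image fun x => (⟨castSite (x - unitVec ⟨0, h0⟩), ⟨0, h0⟩⟩ : PBond P k))
    {X : GaugeSlice S T (EuclideanSpace ℝ (Fin 3))} (hX : X ≠ 0) :
    0 < deriv (deriv fun s : ℝ => wilsonAction4 (expMul su2Chart (s • ιA S T X) (1 : GaugeField P k SU2))) 0 := by
  have h := sliceNormSq_le_secondVariation_flat h0 h1 hN hK0 hK1 hS hT X
  have hXpos : 0 < ‖X‖ ^ 2 := by positivity
  have hc : 0 ≤ 3 * (K : ℝ) ^ 2 + 2 * (K : ℝ) ^ 4 := by positivity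
  by_contra hle
  rw [not_lt] at hle
  have : ‖X‖ ^ 2 ≤ 0 := h.trans (mul_nonpos_of_nonneg_of_nonpos hc hle)
  linarith

/-- ★ **THE `h17` BINDER OF `ineq19_slice_of_17` AT THE FLAT BACKGROUND, `γ₀ = 1`, `Cerr = 0`**: for ANY real inner-product space `F`, linear `H : GaugeSlice → F` and
`Δ₁ : F → F` whose pairing REALISES the flat second variation along the slice chart (`⟪HX, Δ₁HX⟫ = d²∕ds² A(exp(is·ιA X)·1)∣₀` — e.g. the fine field `φ∘ιA X` with the
flat Hessian operator), the one-sided (1.7) letter holds with `γ₀ = 1` and no error: `1·(Σ_{z∈box(n+3)(lo−2)} Σ_μ Σ_a curl²) − 0·‖X‖² ≤ ⟪HX, Δ₁HX⟫`.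
[cite: Balaban1989LargeFieldII, (1.7) p.358, p.357] -/
theorem h17_flat (h0 : 0 < P.d) (h1 : 1 < P.d) {lo : Fin P.d → ℤ} {n : Fin P.d → ℕ} (hN : ∀ κ, (n κ : ℤ) + 5 < P.sitesPerDir k)
    {S : Set (Site P k)} {T : Finset (PBond P k)}
    {F : Type*} [NormedAddCommGroup F] [InnerProductSpace ℝ F]
    (H : GaugeSlice S T (EuclideanSpace ℝ (Fin 3)) →ₗ[ℝ] F) (Δ₁ : F →ₗ[ℝ] F)
    (hreal : ∀ X : GaugeSlice S T (EuclideanSpace ℝ (Fin 3)),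
      inner ℝ (H X) (Δ₁ (H X)) = deriv (deriv fun s : ℝ => wilsonAction4 (expMul su2Chart (s • ιA S T X) (1 : GaugeField P k SU2))) 0)
    (X : GaugeSlice S T (EuclideanSpace ℝ (Fin 3))) :
    1 * (∑ z ∈ box (fun i => n i + 3) (fun i => lo i - 2), ∑ μ : Fin P.d, ∑ a : Fin 3,
        curl (fun b : (Fin P.d → ℤ) × Fin P.d => ιA S T X (⟨castSite b.1, b.2⟩ : PBond P k) a) z ⟨0, h0⟩ μ ^ 2) - 0 * ‖X‖ ^ 2
      ≤ inner ℝ (H X) (Δ₁ (H X)) := by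
  rw [hreal, one_mul, zero_mul, sub_zero, deriv_deriv_wilsonAction4_expMul_su2Chart_one]
  exact sum_box_curl_sq_le_sum_plaq h0 h1 (fun κ => by have := hN κ; push_cast; omega) (ιA S T X)

end Junction

end Literature.MathematicalPhysics.QuantumFieldTheory.Balaban1983to89.B16Ineq19FlatSliceChart

end
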